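import Summits.BirchSwinnertonDyer.BirchSwinnertonDyer.Theorems.SignedLowerHalvesKobayashiMainConjectureSmallImageLambdaTransferCM
import Summits.BirchSwinnertonDyer.BirchSwinnertonDyer.Theorems.SignedLowerHalvesKobayashiLowerHalfLargeImageCongruencePlaces
import Summits.BirchSwinnertonDyer.BirchSwinnertonDyer.Theorems.SignedLowerHalvesKobayashiMainConjectureSmallImageCMTransferRecordsE
import Literature.NumberTheory.GaloisRepresentations.GL2F5OrderThree
import HarnessLib

/-!
# Route `SignedLowerHalves`, crux `KobayashiMainConjectureSmallImage` (item stmt-BirchSwinnertonDyer-19002):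
# small-image congruence road («L4-λ») — RECORDS part 04: the pair `(50112bq1, 5)`, BOTH signs, and
# `BSD(E,5)` for it in analytic rank one (cell `bsd-ssimc`, seat `bsd-ssimc-k3-c4` gen 6; planner ruling
# D23-7; a `--supports stmt-BirchSwinnertonDyer-19002 --as helper` file; closes nothing about the crux)

PARTITION (cell bsd-ssimc): X7 (A7) × ONE item-4 window pair — `50112bq1 @ 5` (`ρ̄_{E,5}` = 5Nn,
`r_an = 1`, `λ± = 1`; sign `−1` was already PRE-free by the rank-one squeeze p450713, sign `+1` stood MODULO
the Corpuz–Lei preprint binder for want of an even-layer row in the tree, `…CMTransferRecordsE.lean`) —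
closes PER PAIR (Kobayashi's signed main conjecture for both signs from PUBLISHED facts + displayed
certificates — at `p = 5` the `5`-congruence is Fisher's indirect Hesse family, named fact `hF′` = Fisher
2013 Thm. 5.8, PUBLISHED —, and `BSD(E,5)` through Burungale–Kobayashi–Ota Cor. A.5 with its two displayed
referee flags); the crux `KobayashiMainConjectureSmallImage` stays OPEN; nothing booked; BSD is not proved
by any of this. THEOREMS ONLY.

## The record (shape `SmallImageCongruenceRoad.kobayashiMainConjecture_{neg_one,one}_of_cmPartner_of_mazurTate`)

Target `E = [0,0,0,−12540,321104]` (Cremona 50112bq1, `N = 50112 = 2⁶·3³·29`); partner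
`A = [0,0,0,0,−32] : y² = x³ − 32` (Cremona 1728m1, `N′ = 1728 = 2⁶·3³`, CM by `ℤ[ζ₃]`, `5` inert, `r_an = 0`,
unit zone `L(A,1)/Ω_A = 1`), `E[5] ≃ A[5]` by `fiveCongruent_of_hesseIndCertificate` (indirect Hesse family of
`A` at `(λ:μ) = (24:1)`, `u = 5283615080448`, as in `…CMTransferRecordsE.lean`; MODULO Fisher's PUBLISHED
`thm58_fiveCongruent_hessePencilInd`, binder `hF′`). CERTIFICATES (kit **j261781**, engines B = b2b lit-g7
msengine and T = iw-2 twisted `L`-values; evidence on the item; file of record HOME/bsd-ssimc-k3-c4/g6/):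
`E`: odd layer `θ_1`, `(μ, λ) = (0, 1) = (0, deg ω_1^+ + 1)` — B AND T (`V = 1 < 4`, CERTIFIED; = the tree's
two-engine row `MazurTateRecordsBWX7RankOneC.lean` :126, engines B/T j094264/j098044); even layer `θ_2`,
`(μ, λ) = (0, 5) = (0, deg ω_2^- + 1)` — B AND T (`V = 5 < 20`, CERTIFIED; = b2b iw-2 `engT_layers.tsv`);
`A`: `θ_1`, `(0, 0)`, `θ_2`, `(0, 4) = (0, 4 + 0)` — B, T (exact match with PARI `msfromell`) and A
(`ellpadiclambdamu = [[0,0],[0,0]]`). `Σ₀ = {2, 3, 29}`, KERNEL-DECIDED by the place toolkit (p465598):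
`δ_E = (0, 0, 0)` (additive, additive, split `29 ≢ 1 (mod 5)`), `δ_A = (0, 0, 1)` (additive, additive, good
`#Ã(𝔽_29) = 30 ≡ 0`, `29 ≢ 1`, `s_29 = 1`); bookkeeping `1 + 0 = 0 + 1` for both signs. Published inputs BY
NAME (`h12 h41 h5 h3 h09 hKim hPR hmod hPollack hF′`; `hA5 hmod' hGZK` for `BSD(E,5)`). NO `Surj`, NO preprint.

References: [Kobayashi2003] Conj. (p. 2), Thm. 1.2, 4.1; [BDKim2009] Cor. 2.13, 2.5, Prop. 2.6;
[PollackRubin2004] Thm. (p. 448); [Pollack2003] Def. 6.15, Prop. 6.9/6.10/6.18; [Fisher2013QuinticTwists]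
Thm. 5.8; [GreenbergVatsal2000] Prop. (2.4); [BurungaleKobayashiOta2023] Cor. A.5; [Cremona2006] Table 1
(50112bq1, 1728m1).
-/

set_option autoImplicit false
set_option linter.dupNamespace false
noncomputable section

open scoped Classical MatrixGroups ModularForm BigOperators

open CongruenceSubgroup WeierstrassCurve NumberField IsDedekindDomain Rat.HeightOneSpectrum
  Literature.NumberTheory.EllipticCurves
  Literature.NumberTheory.EllipticCurves.ModularForms
  Literature.NumberTheory.EllipticCurves.Rank1Residual
  Literature.NumberTheory.EllipticCurves.Rank1Residual.Typed
  Literature.NumberTheory.EllipticCurves.Kobayashi2003 ZpExtension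
  Literature.NumberTheory.EllipticCurves.GreenbergVatsal2000
  Literature.NumberTheory.EllipticCurves.BDKim2009
  Literature.NumberTheory.EllipticCurves.Fisher2012
  Literature.NumberTheory.EllipticCurves.BurungaleKobayashiOta2024
  Literature.NumberTheory.EllipticCurves.Rank1Residual.X11RankOneCertificates
  Literature.NumberTheory.GaloisRepresentations
  Summit.BirchSwinnertonDyer.Rank1Residual.X1.MuLambda
  Summit.BirchSwinnertonDyer.Rank1Residual.Supersingular
  Summit.BirchSwinnertonDyer.Rank1Residual.X2.LocalDeltaCalculus
  Summit.BirchSwinnertonDyer.BirchSwinnertonDyer.Rank1Residual.IntModel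
  Summit.BirchSwinnertonDyer.BirchSwinnertonDyer.Rank1Residual.X11RankOne
  Summit.BirchSwinnertonDyer.Rank1Residual.X11b
  Summit.BirchSwinnertonDyer.BirchSwinnertonDyer.Theorems.CongruenceRoad

namespace Summit.BirchSwinnertonDyer.BirchSwinnertonDyer.Theorems.SmallImageCongruenceRoad

/-! ### §1 Kernel data of the pair -/

/-- `#Ã(𝔽_29) = 30` for the partner `1728m1 = [0,0,0,0,−32]` (`a_29 = 0`; fast count). [cite: Cremona2006, Table 1 (Cremona label 1728m1)] -/
theorem countPoints_1728m1_29 : countPoints [0, 0, 0, 0, -32] 29 = (30 : ℕ) :=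
  countPoints_eq_of_fast (by decide +kernel)

/-- **The δ-bookkeeping of `(50112bq1, 1728m1)` at `5`, KERNEL-DECIDED**: with `Σ₀` the places over
`{2, 3, 29}` (away from `5`, containing every bad place of both curves), `Σ_{Σ₀} δ_E = 0` and
`Σ_{Σ₀} δ_A = 1`. [cite: GreenbergVatsal2000, §2 Prop. (2.4) (p. 22)] [cite: SilvermanAEC2009, VII.5 Prop. 5.1]
[cite: Cremona2006, Table 1 (Cremona labels 50112bq1, 1728m1)] -/
theorem places_50112bq1_1728m1 (W A : WeierstrassCurve ℚ) [W.IsElliptic] [W.IsGloballyMinimal]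
    [A.IsElliptic] [A.IsGloballyMinimal]
    (hW : W = ⟨0, 0, 0, -12540, 321104⟩) (hA : A = ⟨0, 0, 0, 0, -32⟩) :
    ∃ S₀ : Finset (HeightOneSpectrum (𝓞 ℚ)), (∀ v ∈ S₀, ((5 : ℕ) : 𝓞 ℚ) ∉ v.asIdeal) ∧
      (∀ v : HeightOneSpectrum (𝓞 ℚ), ¬ W.HasGoodReductionAt v → v ∈ S₀) ∧
      (∀ v : HeightOneSpectrum (𝓞 ℚ), ¬ A.HasGoodReductionAt v → v ∈ S₀) ∧
      ∑ v ∈ S₀, delta W 5 v = 0 ∧ ∑ v ∈ S₀, delta A 5 v = 1 := by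
  have hI : integralModelInt W = ⟨0, 0, 0, -12540, 321104⟩ :=
    integralModelInt_eq_of_map_eq _ (by rw [hW]; ext <;> simp [WeierstrassCurve.map])
  have hI' : integralModelInt A = ⟨0, 0, 0, 0, -32⟩ :=
    integralModelInt_eq_of_map_eq _ (by rw [hA]; ext <;> simp [WeierstrassCurve.map])
  set v2 : HeightOneSpectrum (𝓞 ℚ) := (primesEquiv (R := 𝓞 ℚ)).symm ⟨2, Nat.prime_two⟩ with hv2
  set v3 : HeightOneSpectrum (𝓞 ℚ) := (primesEquiv (R := 𝓞 ℚ)).symm ⟨3, Nat.prime_three⟩ with hv3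
  set v29 : HeightOneSpectrum (𝓞 ℚ) := (primesEquiv (R := 𝓞 ℚ)).symm ⟨29, by norm_num⟩ with hv29
  have h29 : ((29 : ℕ) : ZMod 5) ≠ 1 := by decide
  -- δ-terms of `E`: additive at 2, 3; split at 29 (`29 ≢ 1 (mod 5)`)
  have d2 : delta W 5 v2 = 0 :=
    delta_eq_zero_of_dvd_of_dvd hI 5 v2 (by rw [hv2, natGenerator_symm]; decide)
      (by rw [hv2, natGenerator_symm]; decide)
  have d3 : delta W 5 v3 = 0 :=
    delta_eq_zero_of_dvd_of_dvd hI 5 v3 (by rw [hv3, natGenerator_symm]; decide)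
      (by rw [hv3, natGenerator_symm]; decide)
  have d29 : delta W 5 v29 = 0 := by
    rw [delta_eq_of_split hI 5 v29 29 (by norm_num) (by rw [hv29, natGenerator_symm]) (by decide) (by decide)
      ⟨8, by decide +kernel⟩, if_neg h29, mul_zero]
  -- δ-terms of `A`: additive at 2, 3; good at 29 with `#Ã(𝔽_29) = 30 ≡ 0 (mod 5)`, `s_29 = 1`
  have e2 : delta A 5 v2 = 0 :=
    delta_eq_zero_of_dvd_of_dvd hI' 5 v2 (by rw [hv2, natGenerator_symm]; decide)
      (by rw [hv2, natGenerator_symm]; decide)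
  have e3 : delta A 5 v3 = 0 :=
    delta_eq_zero_of_dvd_of_dvd hI' 5 v3 (by rw [hv3, natGenerator_symm]; decide)
      (by rw [hv3, natGenerator_symm]; decide)
  have e29 : delta A 5 v29 = 1 := by
    rw [delta_eq_of_good_of_dvd_count hI' 5 v29 29 (by norm_num) (by rw [hv29, natGenerator_symm]) (by norm_num)
      (by norm_num) rfl (by decide) countPoints_1728m1_29 (by decide),
      sFactor_eq_of_eq_pow_mul (k := 0) (m := 141456) (by norm_num) (by norm_num), if_neg h29]
    norm_num
  have n1 : v2 ∉ ({v3, v29} : Finset (HeightOneSpectrum (𝓞 ℚ))) := by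
    simp only [Finset.mem_insert, Finset.mem_singleton, hv2, hv3, hv29, not_or]
    exact ⟨symm_ne_symm _ _ (by norm_num), symm_ne_symm _ _ (by norm_num)⟩
  have n2 : v3 ∉ ({v29} : Finset (HeightOneSpectrum (𝓞 ℚ))) := by
    simp only [Finset.mem_singleton, hv3, hv29]
    exact symm_ne_symm _ _ (by norm_num)
  refine ⟨{v2, v3, v29}, ?_, ?_, ?_, ?_, ?_⟩
  · intro v hv
    simp only [Finset.mem_insert, Finset.mem_singleton] at hv
    rcases hv with rfl | rfl | rfl
    · exact natCast_not_mem_symm (by norm_num) _ (by norm_num)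
    · exact natCast_not_mem_symm (by norm_num) _ (by norm_num)
    · exact natCast_not_mem_symm (by norm_num) _ (by norm_num)
  · -- `Σ₀ ⊇` bad places of `E`: `Δ(E) = 2¹⁴·3⁵·29⁵`
    intro v hv
    by_contra hvS
    apply hv
    apply hasGoodReductionAt_of_not_dvd hI
    intro hdvd
    have hΔ : (⟨0, 0, 0, -12540, 321104⟩ : WeierstrassCurve ℤ).Δ = 2 ^ 14 * 3 ^ 5 * 29 ^ 5 := by decide
    rw [hΔ] at hdvd
    have hpr := prime_natGenerator v
    have h' : natGenerator v ∣ 2 ^ 14 * 3 ^ 5 * 29 ^ 5 := by exact_mod_cast hdvd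
    have key : natGenerator v = 2 ∨ natGenerator v = 3 ∨ natGenerator v = 29 := by
      rcases (Nat.Prime.dvd_mul hpr).mp h' with h | h
      · rcases (Nat.Prime.dvd_mul hpr).mp h with h | h
        · exact Or.inl ((Nat.prime_dvd_prime_iff_eq hpr Nat.prime_two).mp (hpr.dvd_of_dvd_pow h))
        · exact Or.inr (Or.inl ((Nat.prime_dvd_prime_iff_eq hpr Nat.prime_three).mp (hpr.dvd_of_dvd_pow h)))
      · exact Or.inr (Or.inr ((Nat.prime_dvd_prime_iff_eq hpr (by norm_num)).mp (hpr.dvd_of_dvd_pow h)))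
    apply hvS
    simp only [Finset.mem_insert, Finset.mem_singleton]
    rcases key with h | h | h
    · exact Or.inl (eq_symm_of_natGenerator_eq Nat.prime_two h)
    · exact Or.inr (Or.inl (eq_symm_of_natGenerator_eq Nat.prime_three h))
    · exact Or.inr (Or.inr (eq_symm_of_natGenerator_eq (by norm_num) h))
  · -- `Σ₀ ⊇` bad places of `A`: `Δ(A) = −2¹⁴·3³`
    intro v hv
    by_contra hvS
    apply hv
    apply hasGoodReductionAt_of_not_dvd hI'
    intro hdvd
    have hΔ : (⟨0, 0, 0, 0, -32⟩ : WeierstrassCurve ℤ).Δ = -(2 ^ 14 * 3 ^ 3) := by decide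
    rw [hΔ, dvd_neg] at hdvd
    have hpr := prime_natGenerator v
    have h' : natGenerator v ∣ 2 ^ 14 * 3 ^ 3 := by exact_mod_cast hdvd
    have key : natGenerator v = 2 ∨ natGenerator v = 3 := by
      rcases (Nat.Prime.dvd_mul hpr).mp h' with h | h
      · exact Or.inl ((Nat.prime_dvd_prime_iff_eq hpr Nat.prime_two).mp (hpr.dvd_of_dvd_pow h))
      · exact Or.inr ((Nat.prime_dvd_prime_iff_eq hpr Nat.prime_three).mp (hpr.dvd_of_dvd_pow h))
    apply hvS
    simp only [Finset.mem_insert, Finset.mem_singleton]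
    rcases key with h | h
    · exact Or.inl (eq_symm_of_natGenerator_eq Nat.prime_two h)
    · exact Or.inr (Or.inl (eq_symm_of_natGenerator_eq Nat.prime_three h))
  · norm_num [Finset.sum_insert n1, Finset.sum_insert n2, Finset.sum_singleton, d2, d3, d29]
  · norm_num [Finset.sum_insert n1, Finset.sum_insert n2, Finset.sum_singleton, e2, e3, e29]

/-! ### §2 The records: both signs, and `BSD(E,5)` in analytic rank one -/

/-- **`lam4_50112bq1_5` — Kobayashi's main conjecture for `(50112bq1, 5, ε)`, EITHER sign, AT THE PAIR by
the small-image congruence road (NO preprint, NO `Surj`).** Certificates DISPLAYED as hypotheses: for `E`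
the odd row `θ_1` (`λ = 0 + 1`) if `ε = −1`, the even row `θ_2` (`λ = 4 + 1`) if `ε = 1`; for the CM partner
`A = 1728m1` the rows `θ_1` (`λ = 0 + 0`) / `θ_2` (`λ = 4 + 0`) (kit j261781, engines B + T; engine A
`[[0,0],[0,0]]`). The `5`-congruence is Fisher's indirect Hesse family MODULO the PUBLISHED named fact `hF′`
(Fisher 2013 Thm. 5.8); the δ-bookkeeping `1 + 0 = 0 + 1` is KERNEL-DECIDED. PER PAIR; nothing booked; BSD
is not proved by any of this. [cite: Kobayashi2003, Conjecture (p. 2), Thm. 1.2 and Thm. 4.1]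
[cite: BDKim2009, Cor. 2.13, Cor. 2.5 and Prop. 2.6 (pp. 185–187)] [cite: PollackRubin2004, Theorem (p. 448) = Thm. 7.3]
[cite: Pollack2003, Def. 6.15, Prop. 6.9, 6.10 and 6.18] [cite: Fisher2013QuinticTwists, Thm. 5.8]
[cite: GreenbergVatsal2000, §2 Prop. (2.4)] [cite: Cremona2006, Table 1 (Cremona labels 50112bq1, 1728m1)] -/
theorem lam4_kobayashiMainConjecture_50112bq1_5
    (h12 : Kobayashi2003.thm12_signedSelmerDual_finite_torsion)
    (h41 : Kobayashi2003.thm41_signedCharIdeal_divisibility)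
    (h5 : realPeriodRat_eq_unit_mul_plusPeriod) (h3 : realPeriodRat_eq_unit_mul_plusPeriod_three)
    (h09 : cor213_signedMu_eq_zero_iff_of_torsionIso)
    (hKim : BDKim2009.cor213_signedLambda_add_sum_delta_eq_of_torsionIso)
    (hPR : PollackRubin2004.mainTheorem_signedCharIdeal_eq_of_cm)
    (hmod : nonempty_modularParametrizationData) (hF' : thm58_fiveCongruent_hessePencilInd)
    (W A : WeierstrassCurve ℚ) [W.IsElliptic] [W.IsGloballyMinimal] [A.IsElliptic] [A.IsGloballyMinimal]
    [Fact (Nat.Prime 5)] (hW : W = ⟨0, 0, 0, -12540, 321104⟩) (hA : A = ⟨0, 0, 0, 0, -32⟩)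
    (hPollack : ∀ {N : ℕ} [NeZero N] {f : CuspForm (Gamma0 N) 2},
      pollack_exists_plusMinusPAdicLFunction (W := A) (f := f) (p := 5))
    [NeZero (W.conductorNorm ℤ)] {f₀ : CuspForm (Gamma0 (W.conductorNorm ℤ)) 2} (hf₀ : IsNewformOf W f₀)
    [NeZero (A.conductorNorm ℤ)] {f₀' : CuspForm (Gamma0 (A.conductorNorm ℤ)) 2} (hf₀' : IsNewformOf A f₀')
    (ε : ℤˣ) {Θ Θ' : IwasawaAlgebra 5} (hΘ0 : Θ ≠ 0) (hμ : mu Θ = 0) (hΘ'0 : Θ' ≠ 0) (hμ' : mu Θ' = 0)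
    (hrow : (ε = -1 ∧
        iwasawaToPowerSeries 5 Θ = ((mazurTateElement f₀ 5 1).map (algebraMap ℚ ℚ_[5]) : PowerSeries ℚ_[5]) ∧
        lam Θ = (cyclotomicOmegaPlus 5 1).natDegree + 1 ∧
        iwasawaToPowerSeries 5 Θ' = ((mazurTateElement f₀' 5 1).map (algebraMap ℚ ℚ_[5]) : PowerSeries ℚ_[5]) ∧
        lam Θ' = (cyclotomicOmegaPlus 5 1).natDegree + 0) ∨
      (ε = 1 ∧
        iwasawaToPowerSeries 5 Θ = ((mazurTateElement f₀ 5 2).map (algebraMap ℚ ℚ_[5]) : PowerSeries ℚ_[5]) ∧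
        lam Θ = (cyclotomicOmegaMinus 5 2).natDegree + 1 ∧
        iwasawaToPowerSeries 5 Θ' = ((mazurTateElement f₀' 5 2).map (algebraMap ℚ ℚ_[5]) : PowerSeries ℚ_[5]) ∧
        lam Θ' = (cyclotomicOmegaMinus 5 2).natDegree + 0)) :
    KobayashiMainConjecture W 5 ε := by
  have hI : integralModelInt W = ⟨0, 0, 0, -12540, 321104⟩ :=
    integralModelInt_eq_of_map_eq _ (by rw [hW]; ext <;> simp [WeierstrassCurve.map])
  have hI' : integralModelInt A = ⟨0, 0, 0, 0, -32⟩ :=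
    integralModelInt_eq_of_map_eq _ (by rw [hA]; ext <;> simp [WeierstrassCurve.map])
  have hp2 : (5 : ℕ) ≠ 2 := by decide
  have hSS : GoodSS W 5 := goodSS_of_intModel 5 hI (by decide) card_c50112bq1_5 (by norm_num)
  have hap : W.frobeniusTrace 5 = 0 := by rw [frobeniusTrace_eq hI card_c50112bq1_5]; norm_num
  have hSS' : GoodSS A 5 := goodSS_of_intModel 5 hI' (by decide) card_cm0m32_5 (by norm_num)
  have hap' : A.frobeniusTrace 5 = 0 := by rw [frobeniusTrace_eq hI' card_cm0m32_5]; norm_num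
  have hcm' : A.HasCM := hasCM_cm0m32 hI'
  -- the 5-congruence `E[5] ≃ A[5]`: Fisher's indirect Hesse family of `A` through `E` (named fact `hF′`)
  have hc4 : W.c₄ = (601920 : ℚ) := by
    subst hW; norm_num [WeierstrassCurve.c₄, WeierstrassCurve.b₂, WeierstrassCurve.b₄]
  have hc6 : W.c₆ = (-277433856 : ℚ) := by
    subst hW; norm_num [WeierstrassCurve.c₆, WeierstrassCurve.b₂, WeierstrassCurve.b₄, WeierstrassCurve.b₆]
  have hc4A : A.c₄ = (0 : ℚ) := by
    subst hA; norm_num [WeierstrassCurve.c₄, WeierstrassCurve.b₂, WeierstrassCurve.b₄]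
  have hc6A : A.c₆ = (27648 : ℚ) := by
    subst hA; norm_num [WeierstrassCurve.c₆, WeierstrassCurve.b₂, WeierstrassCurve.b₄, WeierstrassCurve.b₆]
  have he := fiveCongruent_of_hesseIndCertificate hF' A W (24 : ℚ) 1 (5283615080448 : ℚ)
    (by norm_num) (by rw [hc4A, hc6A, hc4, eval_hesseC4ind]; norm_num)
    (by rw [hc4A, hc6A, hc6, eval_hesseC6ind]; norm_num)
  obtain ⟨S₀, hS₀, hS₀W, hS₀A, hsumW, hsumA⟩ := places_50112bq1_1728m1 W A hW hA
  rcases hrow with ⟨rfl, hΘ, hlam, hΘ', hlam'⟩ | ⟨rfl, hΘ, hlam, hΘ', hlam'⟩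
  · exact kobayashiMainConjecture_neg_one_of_cmPartner_of_mazurTate h12 h41 h5 h3 h09 hKim hPR hmod hp2 hSS.1
      hap hf₀ (by decide) hΘ hΘ0 hμ hlam hPollack hcm' hSS' hap' he hf₀' (by decide) hΘ' hΘ'0 hμ' hlam' S₀
      hS₀ hS₀W hS₀A (by rw [hsumW, hsumA])
  · exact kobayashiMainConjecture_one_of_cmPartner_of_mazurTate h12 h41 h5 h3 h09 hKim hPR hmod hp2 hSS.1
      hap hf₀ (by decide) hΘ hΘ0 hμ hlam hPollack hcm' hSS' hap' he hf₀' (by decide) hΘ' hΘ'0 hμ' hlam' S₀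
      hS₀ hS₀W hS₀A (by rw [hsumW, hsumA])

/-- **`BSD(E,5)` for `50112bq1` (X7, `r_an = 1`, `5Nn`) through the IMAGE-FREE rank-one road**
`bsdp_of_kobayashiMainConjecture_of_corA5_of_analyticRank_eq_one` (Burungale–Kobayashi–Ota 2024 Cor. A.5
`hA5` with its two displayed referee flags, `hmod'`, `hGZK`, rank datum `hr`) fed with
`lam4_kobayashiMainConjecture_50112bq1_5` (even rows, `ε = 1` — the sign NOT reached by the squeeze record
`kobayashiMainConjecture_c50112bq1_5_neg_one_of_lvalue_of_mazurTate`). A second, λ-transfer road to a pair the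
tree already closes flag-free at `5`; the NEW content is the sign-`+1` main conjecture without preprint.
PER PAIR; nothing booked; BSD is not proved by any of this. [cite: BurungaleKobayashiOta2023, App. A Cor. A.5]
[cite: Kobayashi2003, Thm. 7.4 and Conjecture (p. 2)] [cite: BDKim2009, Cor. 2.13 (p. 187)] [cite: Miller2011LMS, Def. 1.1]
[cite: Fisher2013QuinticTwists, Thm. 5.8] [cite: Cremona2006, Table 1 (Cremona labels 50112bq1, 1728m1)] -/
theorem lam4_bsdp_50112bq1_5
    (h12 : Kobayashi2003.thm12_signedSelmerDual_finite_torsion)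
    (h41 : Kobayashi2003.thm41_signedCharIdeal_divisibility)
    (h5 : realPeriodRat_eq_unit_mul_plusPeriod) (h3 : realPeriodRat_eq_unit_mul_plusPeriod_three)
    (h09 : cor213_signedMu_eq_zero_iff_of_torsionIso)
    (hKim : BDKim2009.cor213_signedLambda_add_sum_delta_eq_of_torsionIso)
    (hPR : PollackRubin2004.mainTheorem_signedCharIdeal_eq_of_cm)
    (hmod : nonempty_modularParametrizationData) (hmod' : hasEntireLFunction_rat)
    (hF' : thm58_fiveCongruent_hessePencilInd)
    (hA5 : corA5_pPart_of_signedCharIdeal_eq) (hGZK : rank_eq_analyticRank_of_analyticRank_le_one)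
    (W A : WeierstrassCurve ℚ) [W.IsElliptic] [W.IsGloballyMinimal] [A.IsElliptic] [A.IsGloballyMinimal]
    [Fact (Nat.Prime 5)] (hW : W = ⟨0, 0, 0, -12540, 321104⟩) (hA : A = ⟨0, 0, 0, 0, -32⟩)
    (hr : W.analyticRank = 1)
    (hPollack : ∀ {N : ℕ} [NeZero N] {f : CuspForm (Gamma0 N) 2},
      pollack_exists_plusMinusPAdicLFunction (W := A) (f := f) (p := 5))
    [NeZero (W.conductorNorm ℤ)] {f₀ : CuspForm (Gamma0 (W.conductorNorm ℤ)) 2} (hf₀ : IsNewformOf W f₀)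
    [NeZero (A.conductorNorm ℤ)] {f₀' : CuspForm (Gamma0 (A.conductorNorm ℤ)) 2} (hf₀' : IsNewformOf A f₀')
    {Θ Θ' : IwasawaAlgebra 5}
    (hΘ : iwasawaToPowerSeries 5 Θ = ((mazurTateElement f₀ 5 2).map (algebraMap ℚ ℚ_[5]) : PowerSeries ℚ_[5]))
    (hΘ0 : Θ ≠ 0) (hμ : mu Θ = 0) (hlam : lam Θ = (cyclotomicOmegaMinus 5 2).natDegree + 1)
    (hΘ' : iwasawaToPowerSeries 5 Θ' = ((mazurTateElement f₀' 5 2).map (algebraMap ℚ ℚ_[5]) : PowerSeries ℚ_[5]))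
    (hΘ'0 : Θ' ≠ 0) (hμ' : mu Θ' = 0) (hlam' : lam Θ' = (cyclotomicOmegaMinus 5 2).natDegree + 0) :
    BSDp W 5 := by
  have hI : integralModelInt W = ⟨0, 0, 0, -12540, 321104⟩ :=
    integralModelInt_eq_of_map_eq _ (by rw [hW]; ext <;> simp [WeierstrassCurve.map])
  have hp2 : (5 : ℕ) ≠ 2 := by decide
  have hSS : GoodSS W 5 := goodSS_of_intModel 5 hI (by decide) card_c50112bq1_5 (by norm_num)
  have hap : W.frobeniusTrace 5 = 0 := by rw [frobeniusTrace_eq hI card_c50112bq1_5]; norm_num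
  exact bsdp_of_kobayashiMainConjecture_of_corA5_of_analyticRank_eq_one W 5 hA5 hmod' hGZK hp2 hSS.1 hap hr 1
    (lam4_kobayashiMainConjecture_50112bq1_5 h12 h41 h5 h3 h09 hKim hPR hmod hF' W A hW hA hPollack hf₀ hf₀' 1
      hΘ0 hμ hΘ'0 hμ' (Or.inr ⟨rfl, hΘ, hlam, hΘ', hlam'⟩))

end Summit.BirchSwinnertonDyer.BirchSwinnertonDyer.Theorems.SmallImageCongruenceRoad

end
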